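import Literature.Algebra.Polynomial.CasasAlvero.Char47Digits
import Literature.Algebra.Polynomial.CasasAlvero.Degree5
import Literature.Algebra.Polynomial.CasasAlvero.DigitReduction
import HarnessLib

/-!
# Casas-Alvero degrees in characteristic 47: the complete classification

Over EVERY field `K` of characteristic `47`: `CA_d(K) ⟺ d = 0 ∨ d = a·47^k` with `1 ≤ a ≤ 5`.
Ingredients: the digit reduction `CA_d ⇒ d = a·p^k ∧ CA_a` (`DigitReduction.lean`, any field); the positive digits `1, 2, 3, 4`
([GrafVonBothmerEtAl2007, Props. 2, 6], degree `≤ 4`) and `5` (`Degree5.lean`: `47` is not one of the nine bad primes of degree 5,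
and `CA_{5·p^k}` descends from the algebraic closure); and a refutation of every digit `6 ≤ a ≤ 46`:
`6, 7` by the degree-6 / degree-7 bad-prime tables; `11, 14, 18, 23, 27, 35, 36, 37, 38, 39, 46` by the binomial criterion
(`m = 4, 7, 8, 9, 11, 16, 8, 14, 10, 4, 2`); and the twenty-eight remaining digits by the sparse `𝔽_47`-examples of `Char47Digits.lean`
(twenty-six trinomials, tetranomials for `8` and `9`).  `47` is the largest prime below `60` that is bad for degree `6`, hence the largest
characteristic `< 60` whose classification the present method completes.
-/

noncomputable section

open Polynomial

namespace Literature.Algebra.Polynomial.CasasAlvero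

variable (K : Type*) [Field K] [CharP K 47]

/-- `CA_{5·47^k}` over every field of characteristic `47`. [cite: CastryckLaterveerOunaies2012, Thm. 4]
[cite: GrafVonBothmerEtAl2007, Prop. 6] -/
theorem holdsInDegree_five_mul_fortySeven_pow (k : ℕ) : HoldsInDegree K (5 * 47 ^ k) := by
  haveI : Fact (Nat.Prime 47) := ⟨by norm_num⟩
  exact holdsInDegree_five_mul_prime_pow_field K 47 (by norm_num) (by norm_num) (by norm_num) (by norm_num)
    (by norm_num) (by norm_num) (by norm_num) (by norm_num) (by norm_num) k

/-- every digit `6 ≤ a < 47` fails: `¬ CA_a` over every field of characteristic `47`. [folklore] -/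
theorem not_holdsInDegree_digit_of_char_fortySeven {a : ℕ} (h6 : 6 ≤ a) (hap : a < 47) : ¬ HoldsInDegree K a := by
  haveI : Fact (Nat.Prime 47) := ⟨by norm_num⟩
  interval_cases a
  · exact not_holdsInDegree_six_of_charP K 47 (by decide)
  · exact not_holdsInDegree_seven_of_le K 47 (by norm_num) (by norm_num)
  · exact not_holdsInDegree_eight_of_char_47 K
  · exact not_holdsInDegree_nine_of_char_47 K
  · exact not_holdsInDegree_ten_of_char_47 K
  · exact not_holdsInDegree_of_choose_modEq_one K 47 (d := 11) (m := 4) (by norm_num) (by norm_num) (by decide)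
  · exact not_holdsInDegree_twelve_of_char_47 K
  · exact not_holdsInDegree_thirteen_of_char_47 K
  · exact not_holdsInDegree_of_choose_modEq_one K 47 (d := 14) (m := 7) (by norm_num) (by norm_num) (by decide)
  · exact not_holdsInDegree_fifteen_of_char_47 K
  · exact not_holdsInDegree_sixteen_of_char_47 K
  · exact not_holdsInDegree_seventeen_of_char_47 K
  · exact not_holdsInDegree_of_choose_modEq_one K 47 (d := 18) (m := 8) (by norm_num) (by norm_num) (by decide)
  · exact not_holdsInDegree_nineteen_of_char_47 K
  · exact not_holdsInDegree_twenty_of_char_47 K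
  · exact not_holdsInDegree_twentyOne_of_char_47 K
  · exact not_holdsInDegree_twentyTwo_of_char_47 K
  · exact not_holdsInDegree_of_choose_modEq_one K 47 (d := 23) (m := 9) (by norm_num) (by norm_num) (by decide)
  · exact not_holdsInDegree_twentyFour_of_char_47 K
  · exact not_holdsInDegree_twentyFive_of_char_47 K
  · exact not_holdsInDegree_twentySix_of_char_47 K
  · exact not_holdsInDegree_of_choose_modEq_one K 47 (d := 27) (m := 11) (by norm_num) (by norm_num) (by decide)
  · exact not_holdsInDegree_twentyEight_of_char_47 K
  · exact not_holdsInDegree_twentyNine_of_char_47 K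
  · exact not_holdsInDegree_thirty_of_char_47 K
  · exact not_holdsInDegree_thirtyOne_of_char_47 K
  · exact not_holdsInDegree_thirtyTwo_of_char_47 K
  · exact not_holdsInDegree_thirtyThree_of_char_47 K
  · exact not_holdsInDegree_thirtyFour_of_char_47 K
  · exact not_holdsInDegree_of_choose_modEq_one K 47 (d := 35) (m := 16) (by norm_num) (by norm_num) (by decide)
  · exact not_holdsInDegree_of_choose_modEq_one K 47 (d := 36) (m := 8) (by norm_num) (by norm_num) (by decide)
  · exact not_holdsInDegree_of_choose_modEq_one K 47 (d := 37) (m := 14) (by norm_num) (by norm_num) (by decide)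
  · exact not_holdsInDegree_of_choose_modEq_one K 47 (d := 38) (m := 10) (by norm_num) (by norm_num) (by decide)
  · exact not_holdsInDegree_of_choose_modEq_one K 47 (d := 39) (m := 4) (by norm_num) (by norm_num) (by decide)
  · exact not_holdsInDegree_forty_of_char_47 K
  · exact not_holdsInDegree_fortyOne_of_char_47 K
  · exact not_holdsInDegree_fortyTwo_of_char_47 K
  · exact not_holdsInDegree_fortyThree_of_char_47 K
  · exact not_holdsInDegree_fortyFour_of_char_47 K
  · exact not_holdsInDegree_fortyFive_of_char_47 K
  · exact not_holdsInDegree_of_choose_modEq_one K 47 (d := 46) (m := 2) (by norm_num) (by norm_num) (by decide)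

/-- **characteristic 47, complete**: over every field of characteristic `47`,
`CA_d ⟺ d = 0 ∨ d = a·47^k` with `1 ≤ a ≤ 5`. [cite: GrafVonBothmerEtAl2007, Props. 2, 6, 7]
[cite: CastryckLaterveerOunaies2012, Thm. 4] -/
theorem classification_char_fortySeven_complete (d : ℕ) :
    HoldsInDegree K d ↔ d = 0 ∨ ∃ k a : ℕ, 0 < a ∧ a ≤ 5 ∧ d = a * 47 ^ k := by
  haveI : Fact (Nat.Prime 47) := ⟨by norm_num⟩
  constructor
  · intro h
    rcases Nat.eq_zero_or_pos d with rfl | hd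
    · exact Or.inl rfl
    obtain ⟨k, a, ha0, hap, rfl, ha⟩ := digit_of_holdsInDegree K 47 hd.ne' h
    refine Or.inr ⟨k, a, ha0, ?_, rfl⟩
    by_contra h5
    exact not_holdsInDegree_digit_of_char_fortySeven K (by omega) hap ha
  · rintro (rfl | ⟨k, a, ha0, ha5, rfl⟩)
    · exact holdsInDegree_zero K
    · interval_cases a
      · simpa using holdsInDegree_prime_pow_field K 47 k
      · exact holdsInDegree_two_mul_prime_pow_field K 47 k
      · exact holdsInDegree_three_mul_prime_pow_field K 47 (by norm_num) k
      · exact holdsInDegree_mul_prime_pow_field K 47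
          (holdsInDegree_of_le_four_of_charP (AlgebraicClosure K) 47 (by norm_num) le_rfl) k
      · exact holdsInDegree_five_mul_fortySeven_pow K k

/-- the set of Casas-Alvero degrees `≤ 2209` in characteristic `47`, explicitly. [folklore] -/
theorem holdsInDegree_iff_mem_of_le_char_fortySeven_sq {d : ℕ} (hd : d ≤ 2209) :
    HoldsInDegree K d ↔ d ∈ ({0, 1, 2, 3, 4, 5, 47, 94, 141, 188, 235, 2209} : Finset ℕ) := by
  rw [classification_char_fortySeven_complete]
  constructor
  · rintro (rfl | ⟨k, a, ha0, ha5, rfl⟩)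
    · decide
    · rcases k with _ | _ | _ | k
      · interval_cases a <;> decide
      · interval_cases a <;> decide
      · interval_cases a <;> simp_all
      · exfalso
        have : 47 ^ 3 ≤ a * 47 ^ (k + 1 + 1 + 1) :=
          le_trans (Nat.pow_le_pow_right (by norm_num) (by omega)) (Nat.le_mul_of_pos_left _ ha0)
        omega
  · intro h
    simp only [Finset.mem_insert, Finset.mem_singleton] at h
    rcases h with rfl | rfl | rfl | rfl | rfl | rfl | rfl | rfl | rfl | rfl | rfl | rfl
    · exact Or.inl rfl
    · exact Or.inr ⟨0, 1, by norm_num, by norm_num, by norm_num⟩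
    · exact Or.inr ⟨0, 2, by norm_num, by norm_num, by norm_num⟩
    · exact Or.inr ⟨0, 3, by norm_num, by norm_num, by norm_num⟩
    · exact Or.inr ⟨0, 4, by norm_num, by norm_num, by norm_num⟩
    · exact Or.inr ⟨0, 5, by norm_num, by norm_num, by norm_num⟩
    · exact Or.inr ⟨1, 1, by norm_num, by norm_num, by norm_num⟩
    · exact Or.inr ⟨1, 2, by norm_num, by norm_num, by norm_num⟩
    · exact Or.inr ⟨1, 3, by norm_num, by norm_num, by norm_num⟩
    · exact Or.inr ⟨1, 4, by norm_num, by norm_num, by norm_num⟩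
    · exact Or.inr ⟨1, 5, by norm_num, by norm_num, by norm_num⟩
    · exact Or.inr ⟨2, 1, by norm_num, by norm_num, by norm_num⟩

end Literature.Algebra.Polynomial.CasasAlvero
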